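import Mathlib
import HarnessLib
import Summits.HubbardSuperconductivity.HubbardSuperconductivity.Theorems.KLProgrammeKLRegimeEnginePairTransferDLineEdgeSplit3DoorSharpTC
import Summits.HubbardSuperconductivity.HubbardSuperconductivity.Theorems.KLProgrammeKLRegimeEnginePairTransferDLineSupportCrossedWide

/-!
# Route `KLProgramme` — ENGINE item stmt-HubbardSuperconductivity-20437 `KLRegimeEngineV17F2`, class-#5 STEP (X).3 budget side, pinned pair «88b» /
# located-risk #14 TAIL: the CROSSED pinned-pair `D`-row and its door on the WIDE window `G·|Q_m−x−y|_𝕋 ≤ Λₙ₊₁/8` (was `/16`) under `32π/β ≤ Λₙ₊₁`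
# (cell gate-hubbard-kl, seat hubbard-kl-k3c2-p2 g22; located «(X).3-TAIL-WINDOW», KL STATUS 2026-08-29 ≈00:32Z)

Text-faithful twins (suffix `TCW`) of `dLine_pinned_crossed_signed_le_split3TC` and `dLine_pinned_crossed_split3_doorTC` with the near-form reduction taken from
`klms_weighted_crossed_eq_near_wide`: hypotheses `16π/β ≤ Λₙ₊₁ ↦ 32π/β ≤ Λₙ₊₁` (one more excluded top scale) and `G|Q_m−x−y| ≤ Λₙ₊₁/16 ↦ Λₙ₊₁/8`;
conclusions byte-identical.  With these the crossed regime boundary coincides with the direct one, and the crossed tail rows `WDx_edge_row_le_slots` (c a parameter)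
may be instantiated at `c = 8` (`32c² = 2048` instead of `8192`): the (T3p) tail constant `⌈2711·8192/338⌉ = 65709` becomes `≈ 16427`, below the direct `32855`,
so the knife-edge `(c₄/Klam)² ≤ 1.44(1+klTS)/klTS` of #14's tail moves to the direct row's `≤ 2.87(1+klTS)/klTS`.
Pure composition + algebra over landed rows; the split and its data are binders; nothing asserts (X).3, (c), K3 or superconductivity.
-/

noncomputable section

namespace Summit.HubbardSuperconductivity.HubbardSuperconductivity.Theorems.KLRegimeSplit

set_option linter.dupNamespace false -- summit = problem name (single-conjunct summit), D-0017

open Real Set Finset Complex Literature.MathematicalPhysics.QuantumLattice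
open Literature.Probability.LatticeModels hiding torusSupNorm
open Literature.MathematicalPhysics.QuantumLattice.BandSectorCounting
open Summit.HubbardSuperconductivity.HubbardSuperconductivity.Theorems.KLProgrammeLegKernels
open Summit.HubbardSuperconductivity.HubbardSuperconductivity.Theorems.KLRegimeWick
open Summit.HubbardSuperconductivity.HubbardSuperconductivity.Theorems.TwoPointAssembly
open Summit.HubbardSuperconductivity.HubbardSuperconductivity.Theorems.DispersionFlow
open Summit.HubbardSuperconductivity.HubbardSuperconductivity.Theorems.PerturbedFermiCurve

variable {L M : ℕ} [NeZero L] [NeZero M] (β μ : ℝ) (K : TrigPolyC4v)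

section Wide

variable {a' b' : ℝ} (B : BandBounds a' b') {R : RenConsts} {U : ℝ} {N : ℕ} {A : ℝ}

/-- **THE PINNED PAIR's CROSSED `D`-ROW, THREE-WAY SPLIT `V_j⊗V_j = c + F₁ + F₂`** (`n+2 ≤ j`, window `G|p_{Q_m−x−y}| ≤ Λₙ₊₁/16`, `16π/β ≤ Λₙ₊₁`, read at
`n+2`): `c` constant (data `(‖c‖, 0, 0)`), `F₁` with data `(A₁, L₁, ε₁)`, `F₂` of sup `A₂` supported in `|k − cen|_𝕋 ≤ ρ` ⟹
`‖S_{D,x}‖ ≤ c-row + (F₁-row + ε₁·flat) + A₂·(256/3)(βL²)²/Λ(t)²·(2·(15381(ρ/π + 1/L)·Λₙ₊₁·βL²))`. -/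
theorem dLine_pinned_crossed_signed_le_split3TCW (hR : ∀ j, 0 ≤ R.Gfr j) (hK : FrameOK R U N μ K)
    (hAb : ∀ p : Momentum, ∀ j ≤ 2, ‖iteratedFDeriv ℝ j (frameShift K) p‖ ≤ A) (hA : 4 * A < B.Dtmin) (hA20 : 4 * A ≤ 1 / 20) (hμ : μ ≤ -0.15)
    (n : ℕ) {t : ℝ} (ht : t ∈ Icc (0 : ℝ) 1) (hβ : klBetaMin ≤ β) (hβL : β ≤ L) (hn : n + 1 ≤ nScales β + 1) (hβn : 32 * π / β ≤ klScale klE0 (n + 1))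
    (hM : β * (4 * klScale klE0 (n + 1)) / (2 * Real.pi) + 1 ≤ M)
    (Wd : ℝ → FreqMomentum L M → ℝ) (hWd : Wd = fun t k => deriv (fun Λ' : ℝ => hubbardCutoffWeightCT L M β μ K Λ' k) (klScale klE0 n + t * (klScale klE0 (n + 1) - klScale klE0 n)))
    (V : ℕ → ℝ → (Fin 4 → HubbardFieldIdx L M) → ℂ) {j : ℕ} (hj : n + 2 ≤ j) (Qm x y : TorusSite 2 L)
    (hlo : a' < μ - 4 * klScale klE0 (n + 1) - 4 * A) (hhi : μ + 4 * klScale klE0 (n + 1) + 4 * A < b')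
    (hq : (4 + 8 / 3 * R.Gfr 1 * U ^ 2) * klTorusNorm L (Qm - x - y) ≤ klScale klE0 (n + 1) / 8)
    (c : ℂ) (F₁ F₂ : FreqMomentum L M → FreqMomentum L M → ℂ) (F₁₀ : TorusSite 2 L → TorusSite 2 L → ℂ)
    (hsplit : ∀ (p p' : FreqMomentum L M),
      V j t ![((p, 0), 1), ((p', 1), 0), (((omega0 M, y), 0), 0), ((((omega0 M).rev, Qm - x), 1), 1)] *
          V j t ![((p, 0), 0), ((p', 1), 1), ((((omega0 M).rev, Qm - y), 1), 0), (((omega0 M, x), 0), 1)] = c + F₁ p p' + F₂ p p')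
    {A₁ L₁ ε₁ : ℝ} (hA1 : 0 ≤ A₁) (hL1 : 0 ≤ L₁) (hε1 : 0 ≤ ε₁)
    (hY0B₁ : ∀ k : TorusSite 2 L, ‖F₁₀ k (k + (Qm - x - y))‖ ≤ A₁)
    (hY1B₁ : ∀ k k' : TorusSite 2 L, ‖F₁₀ k (k + (Qm - x - y)) - F₁₀ k' (k' + (Qm - x - y))‖ ≤ L₁ * klTorusNorm L (k - k'))
    (hY0A₁ : ∀ k : TorusSite 2 L, ‖F₁₀ (k + -(Qm - x - y)) k‖ ≤ A₁)
    (hY1A₁ : ∀ k k' : TorusSite 2 L, ‖F₁₀ (k + -(Qm - x - y)) k - F₁₀ (k' + -(Qm - x - y)) k'‖ ≤ L₁ * klTorusNorm L (k - k'))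
    (hflat₁ : ∀ (i i' : MatsubaraIdx M) (k k' : TorusSite 2 L), matsubaraInt M i' + 1 = matsubaraInt M i →
      matsubaraFreq β M i ^ 2 ≤ (5 * klScale klE0 (n + 1)) ^ 2 → ‖F₁ (i, k) (i', k') - F₁₀ k k'‖ ≤ ε₁)
    (cen : TorusSite 2 L) {ρ A₂ : ℝ} (hρ : 0 ≤ ρ) (hA2 : 0 ≤ A₂)
    (hF₂ : ∀ (p p' : FreqMomentum L M), ‖F₂ p p'‖ ≤ A₂)
    (hsupp₂ : ∀ (p p' : FreqMomentum L M), ρ < klTorusNorm L (p.2 - cen) → F₂ p p' = 0) :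
    ‖∑ p : FreqMomentum L M, ∑ p' : FreqMomentum L M,
        if matsubaraInt M p'.1 + matsubaraInt M (omega0 M) + matsubaraInt M (omega0 M) + 1 = matsubaraInt M p.1 ∧ p'.2 = p.2 + Qm - x - y then
          ((((((softSymbolCompl L M β μ K (n + 1) j p - softSymbolCompl L M β μ K (n + 1) (n + 1) p) : ℝ) : ℂ) * (((β * (L : ℝ) ^ 2 : ℝ) : ℂ) * propCT L M β μ K p)) *
                ((((Wd t p') : ℝ) : ℂ) * (((β * (L : ℝ) ^ 2 : ℝ) : ℂ) * propCT L M β μ K p'))) +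
              (((((Wd t p) : ℝ) : ℂ) * (((β * (L : ℝ) ^ 2 : ℝ) : ℂ) * propCT L M β μ K p)) *
                ((((softSymbolCompl L M β μ K (n + 1) j p' - softSymbolCompl L M β μ K (n + 1) (n + 1) p') : ℝ) : ℂ) * (((β * (L : ℝ) ^ 2 : ℝ) : ℂ) * propCT L M β μ K p')))) *
            (V j t ![((p, 0), 1), ((p', 1), 0), (((omega0 M, y), 0), 0), ((((omega0 M).rev, Qm - x), 1), 1)] *
              V j t ![((p, 0), 0), ((p', 1), 1), ((((omega0 M).rev, Qm - y), 1), 0), (((omega0 M, x), 0), 1)])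
        else 0‖ ≤
      (β * (L : ℝ) ^ 2) ^ 2 *
          (β * (L : ℝ) ^ 2 * klmsRowBoundTC B.Dtmin A (4 + 8 / 3 * R.Gfr 1 * U ^ 2) ‖c‖ 0 β n (n + 2)
              (|-(2 * π / β)| + (4 + 8 / 3 * R.Gfr 1 * U ^ 2) * klTorusNorm L (Qm - x - y)) L +
            β * (L : ℝ) ^ 2 * klmsRowBoundTC B.Dtmin A (4 + 8 / 3 * R.Gfr 1 * U ^ 2) ‖c‖ 0 β n (n + 2)
              (|2 * π / β| + (4 + 8 / 3 * R.Gfr 1 * U ^ 2) * klTorusNorm L (Qm - x - y)) L) +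
      ((β * (L : ℝ) ^ 2) ^ 2 *
          (β * (L : ℝ) ^ 2 * klmsRowBoundTC B.Dtmin A (4 + 8 / 3 * R.Gfr 1 * U ^ 2) A₁ L₁ β n (n + 2)
              (|-(2 * π / β)| + (4 + 8 / 3 * R.Gfr 1 * U ^ 2) * klTorusNorm L (Qm - x - y)) L +
            β * (L : ℝ) ^ 2 * klmsRowBoundTC B.Dtmin A (4 + 8 / 3 * R.Gfr 1 * U ^ 2) A₁ L₁ β n (n + 2)
              (|2 * π / β| + (4 + 8 / 3 * R.Gfr 1 * U ^ 2) * klTorusNorm L (Qm - x - y)) L) +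
        ε₁ * (256 / 3 * (β * (L : ℝ) ^ 2) ^ 2 / (klScale klE0 n + t * (klScale klE0 (n + 1) - klScale klE0 n)) ^ 2 *
          ∑ p : FreqMomentum L M, |softSymbolCompl L M β μ K (n + 1) (n + 2) p - softSymbolCompl L M β μ K (n + 1) (n + 1) p| * ‖propCT L M β μ K p‖)) +
      A₂ * (256 / 3 * (β * (L : ℝ) ^ 2) ^ 2 / (klScale klE0 n + t * (klScale klE0 (n + 1) - klScale klE0 n)) ^ 2 *
        (2 * (15381 * (ρ / π + ((L : ℝ))⁻¹) * klScale klE0 (n + 1) * β * (L : ℝ) ^ 2))) := by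
  have hβ0 : 0 < β := lt_of_lt_of_le (by norm_num [klBetaMin]) hβ
  have hΛ1 := klth_klScale_pos (n + 1)
  have hq' : (4 + 8 / 3 * R.Gfr 1 * U ^ 2) * klTorusNorm L (Qm - x - y) ≤ (klScale klE0 n + t * (klScale klE0 (n + 1) - klScale klE0 n)) / 8 := by
    have := (scaleAt_mem n ht).1; linarith
  have hq8 : (4 + 8 / 3 * R.Gfr 1 * U ^ 2) * klTorusNorm L (Qm - x - y) ≤ klScale klE0 (n + 1) / 8 := hq
  have hβn16 : 16 * π / β ≤ klScale klE0 (n + 1) := by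
    have h0 : 0 ≤ 16 * π / β := by positivity
    have e : 32 * π / β = 2 * (16 * π / β) := by ring
    linarith
  -- (1) reduce the weight to `s_{n+1,n+2} − s_{n+1,n+1}` (WIDE window)
  rw [klms_weighted_crossed_eq_near_wide β μ K hR hK hβ0 n hβn hj ht hq'
    (fun p => softSymbolCompl L M β μ K (n + 1) j p - softSymbolCompl L M β μ K (n + 1) (n + 1) p)
    (fun p => softSymbolCompl L M β μ K (n + 1) (n + 2) p - softSymbolCompl L M β μ K (n + 1) (n + 1) p) (fun k => by ring) Wd hWd]
  -- (2) split the kernel twice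
  set P : FreqMomentum L M → FreqMomentum L M → Prop := fun p p' =>
    matsubaraInt M p'.1 + matsubaraInt M (omega0 M) + matsubaraInt M (omega0 M) + 1 = matsubaraInt M p.1 ∧ p'.2 = p.2 + Qm - x - y with hP
  set ln : FreqMomentum L M → FreqMomentum L M → ℂ := fun p p' =>
    (((((softSymbolCompl L M β μ K (n + 1) (n + 2) p - softSymbolCompl L M β μ K (n + 1) (n + 1) p) : ℝ) : ℂ) * (((β * (L : ℝ) ^ 2 : ℝ) : ℂ) * propCT L M β μ K p)) *
        ((((Wd t p') : ℝ) : ℂ) * (((β * (L : ℝ) ^ 2 : ℝ) : ℂ) * propCT L M β μ K p'))) +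
      (((((Wd t p) : ℝ) : ℂ) * (((β * (L : ℝ) ^ 2 : ℝ) : ℂ) * propCT L M β μ K p)) *
        ((((softSymbolCompl L M β μ K (n + 1) (n + 2) p' - softSymbolCompl L M β μ K (n + 1) (n + 1) p') : ℝ) : ℂ) * (((β * (L : ℝ) ^ 2 : ℝ) : ℂ) * propCT L M β μ K p'))) with hln
  have e := ((pinned_crossed_sum_kernel_congr P ln hsplit).trans (pinned_crossed_sum_kernel_add P ln (fun p p' => c + F₁ p p') F₂)).trans
    (congrArg (· + _) (pinned_crossed_sum_kernel_add P ln (fun _ _ => c) F₁))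
  simp only [hP, hln] at e
  rw [e]
  -- (3) the three rows at index `n+2`
  have hc := klms_adjacent_crossed_signed_le_genTC β μ K B hR hK hAb hA hA20 hμ n ht hβ hn hβn16 hM Wd hWd (j := n + 2) (by omega) Qm x y hlo hhi hq8
    (fun _ _ => c) (fun _ _ => c) (A₀ := ‖c‖) (LA := 0) (ε := 0) (norm_nonneg c) le_rfl le_rfl
    (fun k => le_rfl) (fun k k' => by simp) (fun k => le_rfl) (fun k k' => by simp) (fun i i' k k' _ _ => by simp)
  rw [zero_mul, add_zero] at hc
  have h1 := klms_adjacent_crossed_signed_le_genTC β μ K B hR hK hAb hA hA20 hμ n ht hβ hn hβn16 hM Wd hWd (j := n + 2) (by omega) Qm x y hlo hhi hq8 F₁ F₁₀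
    hA1 hL1 hε1 hY0B₁ hY1B₁ hY0A₁ hY1A₁ hflat₁
  have hw : ∀ k : FreqMomentum L M, 0 ≤ (fun p : FreqMomentum L M => softSymbolCompl L M β μ K (n + 1) (n + 2) p - softSymbolCompl L M β μ K (n + 1) (n + 1) p) k ∧
      (fun p : FreqMomentum L M => softSymbolCompl L M β μ K (n + 1) (n + 2) p - softSymbolCompl L M β μ K (n + 1) (n + 1) p) k ≤
        1 - hubbardCutoffWeightCT L M β μ K (klScale klE0 (n + 1)) k :=
    fun k => softSymbolCompl_sub_compl_mem β μ K (n + 1) (show n + 1 ≤ n + 2 by omega) k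
  have h2 := klms_weighted_crossed_norm_le_of_support_soft β μ K hK hβ hβL n (n + 1) ht hw Wd hWd F₂ Qm x y cen hρ hA2 hF₂ hsupp₂
  exact (norm_add_le _ _).trans (add_le_add ((norm_add_le _ _).trans (add_le_add hc h1)) h2)

/-- **CROSSED THREE-WAY SPLIT ROW IN THE DOOR's NORMALISATION**: `(Λₙ−Λₙ₊₁)((βL²)³)⁻¹·‖S_{D,x}‖ ≤ (Λₙ−Λₙ₊₁)(Row_{n+2}(‖c‖,0; δ₋) + Row_{n+2}(‖c‖,0; δ₊)) +
(Λₙ−Λₙ₊₁)(Row_{n+2}(A₁,L₁; δ₋) + Row_{n+2}(A₁,L₁; δ₊)) + ε₁·(512·15367) + A₂·(1024·15381)·(ρ/π + 1/L)`, `δ∓ = |∓2π/β| + G·|p_{Q_m−x−y}|_𝕋` (the ROOM rows are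
`pinned_row_le_slots_shiftTC`'s input). -/
theorem dLine_pinned_crossed_split3_doorTCW (hR : ∀ j, 0 ≤ R.Gfr j) (hK : FrameOK R U N μ K)
    (hAb : ∀ p : Momentum, ∀ j ≤ 2, ‖iteratedFDeriv ℝ j (frameShift K) p‖ ≤ A) (hA : 4 * A < B.Dtmin) (hA20 : 4 * A ≤ 1 / 20) (hμ : μ ≤ -0.15)
    (n : ℕ) {t : ℝ} (ht : t ∈ Icc (0 : ℝ) 1) (hβ : klBetaMin ≤ β) (hβL : β ≤ L) (hn : n + 1 ≤ nScales β + 1) (hβn : 32 * π / β ≤ klScale klE0 (n + 1))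
    (hM : β * (4 * klScale klE0 (n + 1)) / (2 * Real.pi) + 1 ≤ M)
    (Wd : ℝ → FreqMomentum L M → ℝ) (hWd : Wd = fun t k => deriv (fun Λ' : ℝ => hubbardCutoffWeightCT L M β μ K Λ' k) (klScale klE0 n + t * (klScale klE0 (n + 1) - klScale klE0 n)))
    (V : ℕ → ℝ → (Fin 4 → HubbardFieldIdx L M) → ℂ) {j : ℕ} (hj : n + 2 ≤ j) (Qm x y : TorusSite 2 L)
    (hlo : a' < μ - 4 * klScale klE0 (n + 1) - 4 * A) (hhi : μ + 4 * klScale klE0 (n + 1) + 4 * A < b')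
    (hq : (4 + 8 / 3 * R.Gfr 1 * U ^ 2) * klTorusNorm L (Qm - x - y) ≤ klScale klE0 (n + 1) / 8)
    (c : ℂ) (F₁ F₂ : FreqMomentum L M → FreqMomentum L M → ℂ) (F₁₀ : TorusSite 2 L → TorusSite 2 L → ℂ)
    (hsplit : ∀ (p p' : FreqMomentum L M),
      V j t ![((p, 0), 1), ((p', 1), 0), (((omega0 M, y), 0), 0), ((((omega0 M).rev, Qm - x), 1), 1)] *
          V j t ![((p, 0), 0), ((p', 1), 1), ((((omega0 M).rev, Qm - y), 1), 0), (((omega0 M, x), 0), 1)] = c + F₁ p p' + F₂ p p')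
    {A₁ L₁ ε₁ : ℝ} (hA1 : 0 ≤ A₁) (hL1 : 0 ≤ L₁) (hε1 : 0 ≤ ε₁)
    (hY0B₁ : ∀ k : TorusSite 2 L, ‖F₁₀ k (k + (Qm - x - y))‖ ≤ A₁)
    (hY1B₁ : ∀ k k' : TorusSite 2 L, ‖F₁₀ k (k + (Qm - x - y)) - F₁₀ k' (k' + (Qm - x - y))‖ ≤ L₁ * klTorusNorm L (k - k'))
    (hY0A₁ : ∀ k : TorusSite 2 L, ‖F₁₀ (k + -(Qm - x - y)) k‖ ≤ A₁)
    (hY1A₁ : ∀ k k' : TorusSite 2 L, ‖F₁₀ (k + -(Qm - x - y)) k - F₁₀ (k' + -(Qm - x - y)) k'‖ ≤ L₁ * klTorusNorm L (k - k'))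
    (hflat₁ : ∀ (i i' : MatsubaraIdx M) (k k' : TorusSite 2 L), matsubaraInt M i' + 1 = matsubaraInt M i →
      matsubaraFreq β M i ^ 2 ≤ (5 * klScale klE0 (n + 1)) ^ 2 → ‖F₁ (i, k) (i', k') - F₁₀ k k'‖ ≤ ε₁)
    (cen : TorusSite 2 L) {ρ A₂ : ℝ} (hρ : 0 ≤ ρ) (hA2 : 0 ≤ A₂)
    (hF₂ : ∀ (p p' : FreqMomentum L M), ‖F₂ p p'‖ ≤ A₂)
    (hsupp₂ : ∀ (p p' : FreqMomentum L M), ρ < klTorusNorm L (p.2 - cen) → F₂ p p' = 0) :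
    (klScale klE0 n - klScale klE0 (n + 1)) * ((β * (L : ℝ) ^ 2) ^ 3)⁻¹ *
        ‖∑ p : FreqMomentum L M, ∑ p' : FreqMomentum L M,
          if matsubaraInt M p'.1 + matsubaraInt M (omega0 M) + matsubaraInt M (omega0 M) + 1 = matsubaraInt M p.1 ∧ p'.2 = p.2 + Qm - x - y then
            ((((((softSymbolCompl L M β μ K (n + 1) j p - softSymbolCompl L M β μ K (n + 1) (n + 1) p) : ℝ) : ℂ) * (((β * (L : ℝ) ^ 2 : ℝ) : ℂ) * propCT L M β μ K p)) *
                  ((((Wd t p') : ℝ) : ℂ) * (((β * (L : ℝ) ^ 2 : ℝ) : ℂ) * propCT L M β μ K p'))) +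
                (((((Wd t p) : ℝ) : ℂ) * (((β * (L : ℝ) ^ 2 : ℝ) : ℂ) * propCT L M β μ K p)) *
                  ((((softSymbolCompl L M β μ K (n + 1) j p' - softSymbolCompl L M β μ K (n + 1) (n + 1) p') : ℝ) : ℂ) * (((β * (L : ℝ) ^ 2 : ℝ) : ℂ) * propCT L M β μ K p')))) *
              (V j t ![((p, 0), 1), ((p', 1), 0), (((omega0 M, y), 0), 0), ((((omega0 M).rev, Qm - x), 1), 1)] *
                V j t ![((p, 0), 0), ((p', 1), 1), ((((omega0 M).rev, Qm - y), 1), 0), (((omega0 M, x), 0), 1)])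
          else 0‖ ≤
      ((klScale klE0 n - klScale klE0 (n + 1)) *
            klmsRowBoundTC B.Dtmin A (4 + 8 / 3 * R.Gfr 1 * U ^ 2) ‖c‖ 0 β n (n + 2) (|-(2 * π / β)| + (4 + 8 / 3 * R.Gfr 1 * U ^ 2) * klTorusNorm L (Qm - x - y)) L +
          (klScale klE0 n - klScale klE0 (n + 1)) *
            klmsRowBoundTC B.Dtmin A (4 + 8 / 3 * R.Gfr 1 * U ^ 2) ‖c‖ 0 β n (n + 2) (|2 * π / β| + (4 + 8 / 3 * R.Gfr 1 * U ^ 2) * klTorusNorm L (Qm - x - y)) L) +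
        ((klScale klE0 n - klScale klE0 (n + 1)) *
            klmsRowBoundTC B.Dtmin A (4 + 8 / 3 * R.Gfr 1 * U ^ 2) A₁ L₁ β n (n + 2) (|-(2 * π / β)| + (4 + 8 / 3 * R.Gfr 1 * U ^ 2) * klTorusNorm L (Qm - x - y)) L +
          (klScale klE0 n - klScale klE0 (n + 1)) *
            klmsRowBoundTC B.Dtmin A (4 + 8 / 3 * R.Gfr 1 * U ^ 2) A₁ L₁ β n (n + 2) (|2 * π / β| + (4 + 8 / 3 * R.Gfr 1 * U ^ 2) * klTorusNorm L (Qm - x - y)) L) +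
        ε₁ * (512 * 15367) + A₂ * (1024 * 15381) * (ρ / π + ((L : ℝ))⁻¹) := by
  have hβ0 : 0 < β := lt_of_lt_of_le (by norm_num [klBetaMin]) hβ
  have hL : (0 : ℝ) < L := by exact_mod_cast Nat.pos_of_ne_zero (NeZero.ne L)
  have hBL : β * (L : ℝ) ^ 2 ≠ 0 := by positivity
  have hκ : 0 ≤ (klScale klE0 n - klScale klE0 (n + 1)) * ((β * (L : ℝ) ^ 2) ^ 3)⁻¹ := by
    refine mul_nonneg ?_ (by positivity)
    rw [klth_klScale_succ]; linarith [klth_klScale_pos n]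
  have h := dLine_pinned_crossed_signed_le_split3TCW β μ K B hR hK hAb hA hA20 hμ n ht hβ hβL hn hβn hM Wd hWd V hj Qm x y hlo hhi hq c F₁ F₂ F₁₀ hsplit
    hA1 hL1 hε1 hY0B₁ hY1B₁ hY0A₁ hY1A₁ hflat₁ cen hρ hA2 hF₂ hsupp₂
  have hE := pinned_flat_le (M := M) β μ K hK hβ hβL n ht hε1 (C := 256 / 3) (by norm_num) (by norm_num)
  have hW := window_flat_le (L := L) β hβ0 n (m := n + 1) le_rfl ht hA2 (C := 256 / 3) (by norm_num) hρ
  exact door_split3_arith hBL h hκ hE hW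

end Wide

end Summit.HubbardSuperconductivity.HubbardSuperconductivity.Theorems.KLRegimeSplit

end
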